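import Summits.ValiantsHypothesis.ValiantsHypothesis.Theorems.PolyaContinuedSignedCoverLittleTransfer
import Summits.ValiantsHypothesis.ValiantsHypothesis.Theorems.PolyaContinuedSignedCoverLittleEarC
import HarnessLib

/-!
# Route PolyaContinued — support item `SignedCoverLittle` (stmt-ValiantsHypothesis-7426):
# forks do not decrease under lifting (step (CS) of the paper proof)

Sequel to `…Transfer.lean` (row bijection `exists_rowPerm_of_labelExponent_eq`, fixed rows
transfer `support_subset_of_labelExponent_eq`) and `…EarC.lean` (`forks`). Setting of the paper
proof `proof-LabelTransfer.md`, §2, in normal form (`φ (i, i) = (i, i)`): two perfect matchings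
`μ, ν` of `H` (as permutations; their non-trivial parts are the dicircuits `γ₊, γ₋`) with images
`δ, δ'` in `E` (`e_φ(μ) = m_δ`, `e_φ(ν) = m_{δ'}`; the dicircuits `δ₊, δ₋`).

* `card_forks_le_of_labelExponent_eq` — **(CS)** `#forks δ δ' ≤ #forks μ ν`: in the notation of
  the paper, `|Cm| ≤ |Vm| − (|V(δ₊) ∩ V(δ₋)| − |arcs δ₊ ∩ arcs δ₋|)`. Proof: a common arc
  `i → μ i = ν i` of `γ₊, γ₋` carries a label which is a common cell of `δ, δ'`: either a common ARC of
  `δ₊, δ₋`, or a loop `(x, x)` at a point `x` fixed by `δ, δ'` but (injectivity of the labelling on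
  each matching, `φ (x, x) = (x, x)`) moved by both `μ` and `ν`; the assignment is injective (the
  row bijection), and `V(δ₊) ∩ V(δ₋) ⊆ Vm` (`support_subset_of_labelExponent_eq`).

With p1's identity (T) `#forks δ₊ δ₋ = 3` for the Little obstruction this gives the hypothesis
`3 ≤ #forks γ₊ γ₋` of `ear_caseB` (`…EarD.lean`).
-/

noncomputable section

namespace Summit.ValiantsHypothesis.PolyaContinued

open MvPolynomial Finset Literature.Combinatorics.SimpleGraph Equiv

variable {n : ℕ}

/-- **(CS) Forks do not decrease under lifting.** In normal form (`φ (i, i) = (i, i)`), if the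
perfect matchings `μ, ν` of the source are labelled by the perfect matchings `δ, δ'` of the target
(`e_φ(μ) = m_δ`, `e_φ(ν) = m_{δ'}`), then `δ, δ'` have at most as many forks as `μ, ν`:
`#{x : δ x ≠ x, δ' x ≠ x, δ x ≠ δ' x} ≤ #{i : μ i ≠ i, ν i ≠ i, μ i ≠ ν i}`. [folklore] -/
theorem card_forks_le_of_labelExponent_eq {φ : Fin n × Fin n → Fin n × Fin n}
    (hφ : ∀ i, φ (i, i) = (i, i)) {μ ν δ δ' : Perm (Fin n)}
    (hμ : (∑ i, Finsupp.single (φ (i, μ i)) 1 : (Fin n × Fin n) →₀ ℕ) = matchingExponent δ)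
    (hν : (∑ i, Finsupp.single (φ (i, ν i)) 1 : (Fin n × Fin n) →₀ ℕ) = matchingExponent δ') :
    (forks δ δ').card ≤ (forks μ ν).card := by
  classical
  -- notation: common moved points `I`, common arcs `C`, forks `F = I \ C`
  set IH := μ.support ∩ ν.support with hIH
  set CH := IH.filter fun i => μ i = ν i with hCH
  set IE := δ.support ∩ δ'.support with hIE
  set CE := IE.filter fun x => δ x = δ' x with hCE
  -- the loops: points moved by `μ` and `ν` but fixed by `δ` and `δ'`
  set R := IH.filter fun x => δ x = x ∧ δ' x = x with hR
  have hFH : CH.card + (forks μ ν).card = IH.card :=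
    Finset.card_filter_add_card_filter_not (s := IH) (fun i => μ i = ν i)
  have hFE : CE.card + (forks δ δ').card = IE.card :=
    Finset.card_filter_add_card_filter_not (s := IE) (fun x => δ x = δ' x)
  -- (a) `IE ⊆ IH`, disjoint from `R`
  have hδμ : δ.support ⊆ μ.support := support_subset_of_labelExponent_eq hφ hμ
  have hδν : δ'.support ⊆ ν.support := support_subset_of_labelExponent_eq hφ hν
  have hRI : R.card + IE.card ≤ IH.card := by
    rw [← Finset.card_union_of_disjoint]
    · refine Finset.card_le_card (Finset.union_subset (Finset.filter_subset _ _) ?_)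
      intro x hx
      rw [hIE, Finset.mem_inter] at hx
      exact Finset.mem_inter.2 ⟨hδμ hx.1, hδν hx.2⟩
    · rw [Finset.disjoint_left]
      intro x hxR hxI
      have h1 := (Finset.mem_filter.1 hxR).2.1
      rw [hIE, Finset.mem_inter, Perm.mem_support] at hxI
      exact hxI.1 h1
  -- (b) the labelling sends common arcs of `μ, ν` injectively into `CE ∪ R`
  let g : Fin n → Fin n := fun i => (φ (i, μ i)).1
  have hg : ∀ i, φ (i, μ i) = (g i, δ (g i)) := fun i =>
    Prod.ext rfl (label_mem_of_eq hμ i).symm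
  have hginj : Function.Injective g := by
    intro i j hij
    have : φ (i, μ i) = φ (j, μ j) := by rw [hg i, hg j, hij]
    exact label_injective_of_eq hμ this
  have hmaps : ∀ i ∈ CH, g i ∈ CE ∪ R := by
    intro i hi
    obtain ⟨hiI, hμν⟩ := Finset.mem_filter.1 hi
    rw [hIH, Finset.mem_inter, Perm.mem_support, Perm.mem_support] at hiI
    -- the label of the common arc is a common cell of `δ, δ'`
    have hδ : δ (g i) = (φ (i, μ i)).2 := label_mem_of_eq hμ i
    have hδ' : δ' (g i) = (φ (i, μ i)).2 := by
      have := label_mem_of_eq hν i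
      rwa [← hμν] at this
    rw [Finset.mem_union]
    by_cases hfix : (φ (i, μ i)).2 = g i
    · -- a loop `(x, x)`: `x` is fixed by `δ, δ'` and moved by `μ, ν`
      right
      have hlab : φ (i, μ i) = (g i, g i) := Prod.ext rfl hfix
      have hμx : μ (g i) ≠ g i := by
        intro hx
        have h1 : φ (g i, μ (g i)) = φ (i, μ i) := by rw [hx, hφ, hlab]
        have h2 : g i = i := label_injective_of_eq hμ h1
        rw [h2] at hx
        exact hiI.1 hx
      have hνx : ν (g i) ≠ g i := by
        intro hx
        have h1 : φ (g i, ν (g i)) = φ (i, ν i) := by rw [hx, hφ, ← hμν, hlab]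
        have h2 : g i = i := label_injective_of_eq hν h1
        rw [h2] at hx
        exact hiI.2 hx
      refine Finset.mem_filter.2 ⟨?_, ?_, ?_⟩
      · rw [hIH, Finset.mem_inter, Perm.mem_support, Perm.mem_support]
        exact ⟨hμx, hνx⟩
      · rw [hδ, hfix]
      · rw [hδ', hfix]
    · -- a common arc of `δ, δ'`
      left
      refine Finset.mem_filter.2 ⟨?_, by rw [hδ, hδ']⟩
      rw [hIE, Finset.mem_inter, Perm.mem_support, Perm.mem_support, hδ, hδ']
      exact ⟨hfix, hfix⟩
  have hCH_le : CH.card ≤ CE.card + R.card :=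
    (Finset.card_le_card_of_injOn g hmaps (fun i _ j _ h => hginj h)).trans
      (Finset.card_union_le _ _)
  omega

end Summit.ValiantsHypothesis.PolyaContinued
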